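import Summits.ABC.IUTFork.Cor312LicenceShallowMultiSlotMinRam
import Summits.ABC.IUTFork.Cor312LicenceShallowGenuineK
import HarnessLib

/-!
# [IUTchIII] Cor. 3.12, branch C — PER DATUM, the hull licence is INHABITED at GENUINE `K`-level data that are TAME and q-SHALLOW:
# `m_p·(l⋆² − 1)·ord_v(q_v) ≤ 2l·l⋆·e(v|p)·(m_p − 1)` at every bad place, `m_p ≤ e(x|p) ≤ p − 2` over every bad prime

PROOF-ONLY record file (no `def`, no new `Prop`, no instance) of the abc-iut cell (WAVE-5 prover seat abc-iut-w5-d009, gen 9; row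
«GENUINE-WINDOW-SMALL-L» §4). TAKES NO SIDE on [IUTchIII] Cor. 3.12 or on any author. Sequel of `Cor312LicenceShallowMultiSlotMinRam.lean`
(the multi-slot licence for realising ideles at the minimum-donation rate `p^{1−1/m_p}`) and of `Cor312LicenceShallowGenuineK.lean` /
`Cor312LicenceShallowMultiSlotGenuineK.lean` (p442024 ✓ / p443270 ✓: the NECESSARY conditions at genuine data).

THE POINT (director-abc 12:07:13Z: after `Conditional.not_hSH_v6K` (abc-iut-C-cert-1, p443604 ✓) the isolated object of branch C is
«per-datum S_H in the undecided window»). At the GENUINE `K`-level Dupuy–Hilado datum `X := Cor312Prov.pilotDataOfK D K` of a collection of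
initial Θ-data `D` ([IUTchI] Def. 3.1) the pilot degrees are INTEGRAL (`P_q(w) = ord_w(q)/(2l) ∈ ℤ_{≥1}`, [IUTchI] Ex. 3.2 (iv),
`twoMulLDvdOrdq_pilotDataOfK`), `P_q(w) = e(w|v)·ord_v(q_v)/(2l)` and `e_w = e(v|p)·e(w|v)`; so the top-label inequality of
`licence_settingPrVolSharp_of_realises_minRam_int` reads, after cancelling `e(w|v)`, as the integer condition
**`m_p·(l⋆² − 1)·ord_v(q_v) ≤ 2l·l⋆·e(v|p)·(m_p − 1)`** on `(l, ord_v(q_v), e(v|p), m_p)` — a q-SHALLOWNESS condition at the place `v` of `F`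
(for `m_p → ∞`: `ord_v(q_v) ≲ 4·e(v|p)·l/(l−1)·l⋆/(l⋆+1)`), to be compared with the NECESSARY `(l⋆ − 1)·ord_v(q_v) < 2l·e(v|p)` of p443270.

WHAT IS PROVED (namespace `Summit.ABC.IUTFork.Thm311.Real` for §1, `…Cor312Prov` for §2–§3):
* `slot_level_of_int` — the arithmetic of the level `k = ⌊(j²P − 1)/e⌋` (generic integers);
* `exists_nat_qPilot_pilotDataOfK` — at a bad place of the genuine datum, `P_q(w) = P ∈ ℕ`, `1 ≤ P`, `2l·P = e(w|v)·ord_v(q_v)`;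
* **`licence_settingPrVolSharp_pilotDataOfK_of_shallow`** — for Θ- and q-ideles REALISING the genuine pilot divisors: if every place `x` of `K`
  over a bad prime `p` is tame with `m_p ≤ e(x|p) ≤ p − 2` (`m_p ≥ 1`) and every bad `w | p` over `v ∈ 𝕍(F)^bad` satisfies
  `m_p·(l⋆² − 1)·ord_v(q_v) ≤ 2l·l⋆·e(v|p)·(m_p − 1)`, then the (xi-f) licence HOLDS at `settingPrVolSharp (pilotDataOfK D K)`;
  **`exists_qPinned_and_hull_settingPrVolSharp_pilotDataOfK_of_shallow`** — branch C's antecedent «∃ ρ qK, QPinned ∧ PilotKummerCompatHull»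
  there (any columns), i.e. the per-datum S_H hypothesis of the (refuted-in-∀-form) line of record is INHABITED at such data.

READING (numbers; nothing about print; nothing asserts that such initial Θ-data exist): together with p443270 the per-datum picture at
genuine data in OUR sharp containers is — REFUTED at deep data (HEX, `not_hSH_v6K`'s witness family), INHABITED at tame data with
`m_p·(l⋆²−1)·ord_v(q_v) ≤ 2l·l⋆·e(v|p)·(m_p−1)`, NECESSARILY `(l⋆−1)·ord_v(q_v) < 2l·e(v|p)` and `p ≥ l + 2`; the inhabited regime sits inside
the q-shallow (small `ord_v(q_v)` relative to `e(v|p)`) corner where Szpiro-type bounds on the `𝕍^bad`-part are immediate. `m_p` is any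
lower bound for the ramification of ALL places of `K` over `p` (`K/ℚ` need not be Galois; at the bad places themselves `e ≥ l`,
abc-iut-w5-d054). HONEST SCOPE as in the companions: OUR sharp containers and Dupuy–Hilado's typed (Ind2) acting per capsule slot and
place; the licence is a STRONGER-THAN-PRINT form of (xi-f); nothing about the printed GLOBAL inequality or the NUMBER-level corollary;
nothing asserts or refutes [IUTchIII] Cor. 3.12; typed ≠ proved; instantiated ≠ endorsed.
[cite: Mochizuki2012, IUTchI Def. 3.1 (b),(c) pp. 61–62; Ex. 3.2 (iv) p. 71; IUTchIII Cor. 3.12 p. 173–175, Step (xi) (xi-f) p. 184, Thm. 3.11 (i) (Ind2) p. 154]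
[cite: DupuyHilado2025, §3.3, §3.4, §3.9, §4.9] [cite: NeukirchANT1999, Ch. II Prop. (5.5), (6.8)] [claim: Mochizuki2012, status: disputed]
for every IUT sentence quoted.
-/

noncomputable section

open Set Function NumberField IsDedekindDomain
open scoped Pointwise

/-! ## §1. The level arithmetic for integral degrees (generic) -/

namespace Summit.ABC.IUTFork.Thm311.Real

/-- **Level arithmetic.** For integers `e, P, j, L, μ ≥ 1` with `j ≤ L` and the TOP-label shallowness `μ·(L² − 1)·P ≤ L·e·(μ − 1)`, the
level `k = ⌊(j²P − 1)/e⌋` satisfies `e·k + 1 ≤ j²P ≤ e·(k + 1)` and `μ·(e·k + 1) ≤ μ·P + j·e·(μ − 1)` (as real numbers, the shape of the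
level windows of `licence_settingPrVolSharp_of_realises_minRam`). [folklore] -/
theorem slot_level_of_int {e P j L μ : ℕ} (he1 : 1 ≤ e) (hP1 : 1 ≤ P) (hj1 : 1 ≤ j) (hjL : j ≤ L) (hμ1 : 1 ≤ μ)
    (hsh : μ * (L ^ 2 - 1) * P ≤ L * e * (μ - 1)) :
    ∃ k : ℤ, (e : ℝ) * k + 1 ≤ ((j : ℕ) : ℝ) ^ 2 * (P : ℝ) ∧ ((j : ℕ) : ℝ) ^ 2 * (P : ℝ) ≤ (e : ℝ) * (k + 1) ∧
      (μ : ℝ) * ((e : ℝ) * k + 1) ≤ (μ : ℝ) * (P : ℝ) + ((j : ℕ) : ℝ) * (e : ℝ) * ((μ : ℝ) - 1) := by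
  have hmono := sq_sub_one_mul_le hj1 hjL
  have hL1 : 1 ≤ L := hj1.trans hjL
  have hshj : μ * (j ^ 2 - 1) * P * L ≤ j * e * (μ - 1) * L := by
    calc μ * (j ^ 2 - 1) * P * L = μ * P * ((j ^ 2 - 1) * L) := by ring
      _ ≤ μ * P * (j * (L ^ 2 - 1)) := Nat.mul_le_mul_left _ hmono
      _ = j * (μ * (L ^ 2 - 1) * P) := by ring
      _ ≤ j * (L * e * (μ - 1)) := Nat.mul_le_mul_left _ hsh
      _ = j * e * (μ - 1) * L := by ring
  have hshj' : μ * (j ^ 2 - 1) * P ≤ j * e * (μ - 1) := Nat.le_of_mul_le_mul_right hshj (by omega)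
  have hjP : 1 ≤ j ^ 2 * P := Nat.one_le_iff_ne_zero.mpr (Nat.mul_ne_zero (pow_ne_zero _ (by omega)) (by omega))
  set k : ℕ := (j ^ 2 * P - 1) / e with hk
  have hk1 : e * k + 1 ≤ j ^ 2 * P := by
    have h0 : k * e ≤ j ^ 2 * P - 1 := by rw [hk]; exact Nat.div_mul_le_self _ _
    rw [mul_comm] at h0
    omega
  have hk2 : j ^ 2 * P ≤ e * (k + 1) := by
    have h0 : j ^ 2 * P - 1 < (j ^ 2 * P - 1) / e * e + e := Nat.lt_div_mul_add (by omega)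
    rw [← hk] at h0
    have h1 : e * (k + 1) = k * e + e := by ring
    rw [h1]
    omega
  have hj2 : 1 ≤ j ^ 2 := Nat.one_le_pow _ _ hj1
  have hk3n : μ * (e * k + 1) ≤ μ * P + j * e * (μ - 1) :=
    calc μ * (e * k + 1) ≤ μ * (j ^ 2 * P) := Nat.mul_le_mul_left _ hk1
      _ = μ * (j ^ 2 - 1) * P + μ * P := by zify [hj2]; ring
      _ ≤ j * e * (μ - 1) + μ * P := Nat.add_le_add_right hshj' _
      _ = μ * P + j * e * (μ - 1) := add_comm _ _
  have hk3r : ((μ * (e * k + 1) : ℕ) : ℝ) ≤ ((μ * P + j * e * (μ - 1) : ℕ) : ℝ) := by exact_mod_cast hk3n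
  push_cast [Nat.cast_sub hμ1] at hk3r
  refine ⟨(k : ℤ), ?_, ?_, ?_⟩
  · exact_mod_cast hk1
  · push_cast; exact_mod_cast hk2
  · push_cast; linarith [hk3r]

end Summit.ABC.IUTFork.Thm311.Real

/-! ## §2. The genuine datum: integral pilot degrees -/

namespace Summit.ABC.IUTFork.Cor312Prov

open Thm311 Thm311.Real Cor312 Cor312.Setting Cor312Vol Literature.IUT.LogThetaLattice Literature.IUT.LogVolume
  Literature.IUT.HodgeTheaters
open Literature.NumberTheory.NumberFields Literature.NumberTheory.GaloisRepresentations.Ultrametric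

variable {F K Fbar : Type} [Field F] [NumberField F] [Field K] [NumberField K] [Algebra F K] [Field Fbar]
  [Algebra F Fbar] [Algebra K Fbar] {E : WeierstrassCurve F} [E.IsElliptic] {l : ℕ} {Pb : BadPlacePredicates K}
  (D : InitialThetaData F K Fbar E l Pb) {logv : PadicLogs K} (hlog : LogvAnalytic logv)
  (M : Type) [Field M] [NumberField M]
  (archPk : ∀ (j : (thetaIndex (pilotDataOfK D K)).Label) (vQ : (thetaIndex (pilotDataOfK D K)).VQ),
    Set ((logShellsDH (pilotDataOfK D K) logv).Packet j vQ))
  (archSub : ∀ (j : (thetaIndex (pilotDataOfK D K)).Label) (v : (thetaIndex (pilotDataOfK D K)).V),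
    Set ((logShellsDH (pilotDataOfK D K) logv).Packet j ((thetaIndex (pilotDataOfK D K)).over v)))
  (Ψ : ℤ → ∀ v : (thetaIndex (pilotDataOfK D K)).V, v ∈ (thetaIndex (pilotDataOfK D K)).Vbad →
    Set ((logShellsDH (pilotDataOfK D K) logv).StarPacket v))
  (act : ℤ → ∀ v : (thetaIndex (pilotDataOfK D K)).V, v ∈ (thetaIndex (pilotDataOfK D K)).Vbad →
    (logShellsDH (pilotDataOfK D K) logv).StarPacket v → Module.End ℚ ((logShellsDH (pilotDataOfK D K) logv).StarPacket v))
  (Mmod : ℤ → ∀ j : (thetaIndex (pilotDataOfK D K)).LabelStar, Set ((logShellsDH (pilotDataOfK D K) logv).GlobalPacket j.1))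
  (region : ℤ → ∀ j : (thetaIndex (pilotDataOfK D K)).LabelStar, FinDivisor M → ∀ vQ : (thetaIndex (pilotDataOfK D K)).VQ,
    Set ((logShellsDH (pilotDataOfK D K) logv).Packet j.1 vQ))
  (n : ℤ) {HT : Type} {LogLink : HT → HT → Type} {IsFull : ∀ {s t : HT}, LogLink s t → Prop}
  (lat : LGPGaussianLogThetaLattice LogLink IsFull)
  {Frd : Type} {IsoF : Frd → Frd → Type} {Ob : Frd → Type} {realify : Frd → Frd} {Strip : Type}
  {IsoS : Strip → Strip → Type} {Mv : ∀ v : (thetaIndex (pilotDataOfK D K)).V, v ∈ (thetaIndex (pilotDataOfK D K)).Vbad → Type}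
  [∀ v h, Monoid (Mv v h)]
  (sig : GlobalLGPFrobenioidSignature (thetaIndex (pilotDataOfK D K)).lstar (thetaIndex (pilotDataOfK D K)).V
    (· ∈ (thetaIndex (pilotDataOfK D K)).Vbad) Frd IsoF Ob realify Strip IsoS Mv)
  (split : SplittingMonoids Mv) {ObΔ : Type} {N : ∀ v : (thetaIndex (pilotDataOfK D K)).V, v ∈ (thetaIndex (pilotDataOfK D K)).Vbad → Type}
  [∀ v h, Monoid (N v h)] (qData : QPilotData ObΔ N)
  (tq : ∀ (pp : Nat.Primes) (x : (thetaIndex (pilotDataOfK D K)).Fibre (.inr pp)),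
    haveI : Fact (pp : ℕ).Prime := ⟨pp.2⟩; kOf (pilotDataOfK D K) pp.1 x)
  (t : ∀ (pp : Nat.Primes) (_ : Fin (pilotDataOfK D K).lstar) (x : (thetaIndex (pilotDataOfK D K)).Fibre (.inr pp)),
    haveI : Fact (pp : ℕ).Prime := ⟨pp.2⟩; kOf (pilotDataOfK D K) pp.1 x)
  (htq0 : ∀ pp x, tq pp x ≠ 0)
  (htq1 : ∀ (pp : Nat.Primes) (x : (thetaIndex (pilotDataOfK D K)).Fibre (.inr pp)),
    haveI : Fact (pp : ℕ).Prime := ⟨pp.2⟩; placeOf (pilotDataOfK D K) pp.1 x ∉ (pilotDataOfK D K).S → ‖tq pp x‖ = 1)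
  (col : ℤ → Column (logShellsDH (pilotDataOfK D K) logv))
  (ht0 : ∀ pp i x, t pp i x ≠ 0)
  (ht : ∀ (pp : Nat.Primes) (i : Fin (pilotDataOfK D K).lstar) (x : (thetaIndex (pilotDataOfK D K)).Fibre (.inr pp)),
    haveI : Fact (pp : ℕ).Prime := ⟨pp.2⟩
    Real.log ‖t pp i x‖ = -((pilotDataOfK D K).thetaPilot i (placeOf (pilotDataOfK D K) pp.1 x)) *
      logNorm K (placeOf (pilotDataOfK D K) pp.1 x) / localDegree K (placeOf (pilotDataOfK D K) pp.1 x))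
  (htq : ∀ (pp : Nat.Primes) (x : (thetaIndex (pilotDataOfK D K)).Fibre (.inr pp)),
    haveI : Fact (pp : ℕ).Prime := ⟨pp.2⟩
    Real.log ‖tq pp x‖ = -((pilotDataOfK D K).qPilot (placeOf (pilotDataOfK D K) pp.1 x)) *
      logNorm K (placeOf (pilotDataOfK D K) pp.1 x) / localDegree K (placeOf (pilotDataOfK D K) pp.1 x))


/-- **Integral pilot degree at a bad place of the genuine `K`-level datum**: `P_q(w) = P ∈ ℕ` with `1 ≤ P` and
`2l·P = e(w|v)·ord_v(q_v)` ([IUTchI] Ex. 3.2 (iv): `2l ∣ ord_w(q)`, `twoMulLDvdOrdq_pilotDataOfK`; `ord_w(q) = e(w|v)·ord_v(q_v) > 0`,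
`ordq_pilotDataOfK`). [cite: Mochizuki2012, IUTchI Ex. 3.2 (iv) p. 71] [cite: DupuyHilado2025, §3.3] -/
theorem exists_nat_qPilot_pilotDataOfK {w : HeightOneSpectrum (𝓞 K)} (hS : w ∈ (pilotDataOfK D K).S) :
    ∃ P : ℕ, (pilotDataOfK D K).qPilot w = P ∧ 1 ≤ P ∧
      2 * l * P = (finBelow F K w).asIdeal.ramificationIdx' w.asIdeal * qParamOrd E (finBelow F K w) := by
  obtain ⟨c, hc⟩ := twoMulLDvdOrdq_pilotDataOfK D w hS
  have hpos := (pilotDataOfK D K).ordq_pos hS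
  have hord := ordq_pilotDataOfK D K hS
  have hl : (pilotDataOfK D K).l = l := pilotDataOfK_l D K
  rw [hl] at hc
  have h5 : 5 ≤ l := D.five_le_l
  have hc0 : 0 < c := by
    by_contra h
    rw [not_lt] at h
    have : (pilotDataOfK D K).ordq w ≤ 0 := by
      rw [hc]; exact mul_nonpos_of_nonneg_of_nonpos (by positivity) h
    omega
  refine ⟨c.toNat, ?_, by omega, ?_⟩
  · rw [(pilotDataOfK D K).qPilot_apply_of_mem hS, hl, hc]
    have hl0 : (2 : ℝ) * (l : ℝ) ≠ 0 := by positivity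
    have : ((c.toNat : ℕ) : ℝ) = ((c : ℤ) : ℝ) := by exact_mod_cast Int.toNat_of_nonneg hc0.le
    rw [this]
    push_cast
    field_simp
  · have h1 : (2 * l * c.toNat : ℤ) = ((finBelow F K w).asIdeal.ramificationIdx' w.asIdeal : ℤ) * (qParamOrd E (finBelow F K w) : ℤ) := by
      rw [Int.toNat_of_nonneg hc0.le, ← hord, hc]
    exact_mod_cast h1

/-! ## §3. The licence and branch C's antecedent at tame q-shallow genuine data -/

/-- **The level windows at the genuine datum from the shallowness inequality** `m_p·(l⋆²−1)·ord_v(q_v) ≤ 2l·l⋆·e(v|p)·(m_p−1)`: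
after cancelling `e(w|v)` (`2l·P_q(w) = e(w|v)·ord_v(q_v)`, `e_w = e(v|p)·e(w|v)`) it is the top-label inequality
`m_p·(l⋆²−1)·P_q(w) ≤ l⋆·e_w·(m_p−1)` of `slot_level_of_int`. [cite: Mochizuki2012, IUTchI Ex. 3.2 (iv) p. 71] [cite: DupuyHilado2025, §3.3, §3.4] -/
theorem level_pilotDataOfK_of_shallow (m : Nat.Primes → ℕ) (hm1 : ∀ pp, 1 ≤ m pp)
    (hshallow : ∀ (pp : Nat.Primes) (w : (thetaIndex (pilotDataOfK D K)).Fibre (.inr pp)),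
      haveI : Fact (pp : ℕ).Prime := ⟨pp.2⟩
      placeOf (pilotDataOfK D K) pp.1 w ∈ (pilotDataOfK D K).S →
        m pp * ((pilotDataOfK D K).lstar ^ 2 - 1) * qParamOrd E (finBelow F K (placeOf (pilotDataOfK D K) pp.1 w)) ≤
          2 * l * (pilotDataOfK D K).lstar * ramIdx F (finBelow F K (placeOf (pilotDataOfK D K) pp.1 w)) * (m pp - 1))
    (pp : Nat.Primes) (i : Fin (pilotDataOfK D K).lstar) (w : (thetaIndex (pilotDataOfK D K)).Fibre (.inr pp))
    (hw : haveI : Fact (pp : ℕ).Prime := ⟨pp.2⟩; placeOf (pilotDataOfK D K) pp.1 w ∈ (pilotDataOfK D K).S) :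
    haveI : Fact (pp : ℕ).Prime := ⟨pp.2⟩
    ∃ k : ℤ, (ramIdx K (placeOf (pilotDataOfK D K) pp.1 w) : ℝ) * k + 1 ≤
        (((i : ℕ) + 1 : ℕ) : ℝ) ^ 2 * (pilotDataOfK D K).qPilot (placeOf (pilotDataOfK D K) pp.1 w) ∧
      (((i : ℕ) + 1 : ℕ) : ℝ) ^ 2 * (pilotDataOfK D K).qPilot (placeOf (pilotDataOfK D K) pp.1 w) ≤
        (ramIdx K (placeOf (pilotDataOfK D K) pp.1 w) : ℝ) * (k + 1) ∧
      (m pp : ℝ) * ((ramIdx K (placeOf (pilotDataOfK D K) pp.1 w) : ℝ) * k + 1) ≤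
        (m pp : ℝ) * (pilotDataOfK D K).qPilot (placeOf (pilotDataOfK D K) pp.1 w) +
          (((i : ℕ) + 1 : ℕ) : ℝ) * (ramIdx K (placeOf (pilotDataOfK D K) pp.1 w) : ℝ) * ((m pp : ℝ) - 1) := by
  haveI : Fact (pp : ℕ).Prime := ⟨pp.2⟩
  set w' := placeOf (pilotDataOfK D K) pp.1 w with hw'
  obtain ⟨P, hP, hP1, hPeq⟩ := exists_nat_qPilot_pilotDataOfK D hw
  have hsh0 := hshallow pp w hw
  set ε : ℕ := (finBelow F K w').asIdeal.ramificationIdx' w'.asIdeal with hε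
  set q : ℕ := qParamOrd E (finBelow F K w') with hq
  set b : ℕ := ramIdx F (finBelow F K w') with hb
  have hram : ramIdx K w' = b * ε := ramIdx_eq_ramIdx_finBelow_mul (F := F) w'
  have hε0 : 0 < ε := Nat.pos_of_ne_zero (ramificationIdx'_finBelow_ne_zero (F := F) K w')
  have h5 : 5 ≤ l := D.five_le_l
  -- cancel `e(w|v)`: `2l·(m(L²−1)P) ≤ 2l·(L·(bε)·(m−1))`
  have hsh : (m pp) * ((pilotDataOfK D K).lstar ^ 2 - 1) * P ≤ (pilotDataOfK D K).lstar * ramIdx K w' * ((m pp) - 1) := by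
    rw [hram]
    have h1 : (m pp) * ((pilotDataOfK D K).lstar ^ 2 - 1) * q * ε ≤
        2 * l * (pilotDataOfK D K).lstar * b * ((m pp) - 1) * ε := Nat.mul_le_mul_right _ hsh0
    have h2 : (m pp) * ((pilotDataOfK D K).lstar ^ 2 - 1) * q * ε =
        2 * l * ((m pp) * ((pilotDataOfK D K).lstar ^ 2 - 1) * P) := by
      calc (m pp) * ((pilotDataOfK D K).lstar ^ 2 - 1) * q * ε
          = (m pp) * ((pilotDataOfK D K).lstar ^ 2 - 1) * (ε * q) := by ring
        _ = (m pp) * ((pilotDataOfK D K).lstar ^ 2 - 1) * (2 * l * P) := by rw [← hPeq]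
        _ = 2 * l * ((m pp) * ((pilotDataOfK D K).lstar ^ 2 - 1) * P) := by ring
    have h3 : 2 * l * (pilotDataOfK D K).lstar * b * ((m pp) - 1) * ε =
        2 * l * ((pilotDataOfK D K).lstar * (b * ε) * ((m pp) - 1)) := by ring
    rw [h2, h3] at h1
    exact Nat.le_of_mul_le_mul_left h1 (by omega)
  have hb1 : 1 ≤ ramIdx K w' := Nat.one_le_iff_ne_zero.mpr (ramIdx_ne_zero K w')
  have hj1 : 1 ≤ (i : ℕ) + 1 := by omega
  have hjL : (i : ℕ) + 1 ≤ (pilotDataOfK D K).lstar := by have := i.2; omega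
  obtain ⟨k, hk1, hk2, hk3⟩ := slot_level_of_int hb1 hP1 hj1 hjL (hm1 pp) hsh
  refine ⟨k, ?_, ?_, ?_⟩
  · rw [hP]; exact hk1
  · rw [hP]; exact hk2
  · rw [hP]; exact hk3

include ht0 ht htq in
/-- **PER DATUM, THE (xi-f) LICENCE HOLDS AT TAME q-SHALLOW GENUINE `K`-LEVEL DATA.** For Θ- and q-ideles REALISING the pilot divisors of
`X := pilotDataOfK D K`: if for every bad prime `p` all places `x | p` of `K` are tame with `m_p ≤ e(x|p) ≤ p − 2` (`m_p ≥ 1`), and at every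
bad `w | p`, `v = w ∩ 𝓞_F`, **`m_p·(l⋆² − 1)·ord_v(q_v) ≤ 2l·l⋆·e(v|p)·(m_p − 1)`**, then abc-iut-c312-1's `Thm311ToCor312.Licence` holds at
abc-iut-c312-7's `settingPrVolSharp X …` (via `licence_settingPrVolSharp_of_realises_minRam`; the level at `(w, j)` is
`⌊(j²P_q(w) − 1)/e_w⌋`). [cite: Mochizuki2012, IUTchI Def. 3.1 (b),(c) pp. 61–62; Ex. 3.2 (iv) p. 71; IUTchIII Step (xi) (xi-f) p. 184]
[cite: DupuyHilado2025, §3.3, §3.4, §4.9] [claim: Mochizuki2012, status: disputed] -/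
theorem licence_settingPrVolSharp_pilotDataOfK_of_shallow (m : Nat.Primes → ℕ) (hm1 : ∀ pp, 1 ≤ m pp)
    (htame : ∀ (pp : Nat.Primes) (x : (thetaIndex (pilotDataOfK D K)).Fibre (.inr pp)),
      haveI : Fact (pp : ℕ).Prime := ⟨pp.2⟩
      (∃ w : (thetaIndex (pilotDataOfK D K)).Fibre (.inr pp), placeOf (pilotDataOfK D K) pp.1 w ∈ (pilotDataOfK D K).S) →
        2 < (pp : ℕ) ∧ m pp ≤ (placeOf (pilotDataOfK D K) pp.1 x).asIdeal.ramificationIdx ℤ ∧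
          (placeOf (pilotDataOfK D K) pp.1 x).asIdeal.ramificationIdx ℤ ≤ (pp : ℕ) - 2)
    (hshallow : ∀ (pp : Nat.Primes) (w : (thetaIndex (pilotDataOfK D K)).Fibre (.inr pp)),
      haveI : Fact (pp : ℕ).Prime := ⟨pp.2⟩
      placeOf (pilotDataOfK D K) pp.1 w ∈ (pilotDataOfK D K).S →
        m pp * ((pilotDataOfK D K).lstar ^ 2 - 1) * qParamOrd E (finBelow F K (placeOf (pilotDataOfK D K) pp.1 w)) ≤
          2 * l * (pilotDataOfK D K).lstar * ramIdx F (finBelow F K (placeOf (pilotDataOfK D K) pp.1 w)) * (m pp - 1)) :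
    Thm311ToCor312.Licence
      (settingPrVolSharp (pilotDataOfK D K) hlog M archPk archSub Ψ act Mmod region n lat sig split qData tq t htq0 htq1) := by
  refine licence_settingPrVolSharp_of_realises_minRam (pilotDataOfK D K) hlog M archPk archSub Ψ act Mmod region n lat sig split qData
    tq t htq0 htq1 ht0 ht htq m hm1 htame (fun pp i w hw => ?_)
  haveI : Fact (pp : ℕ).Prime := ⟨pp.2⟩
  exact level_pilotDataOfK_of_shallow D m hm1 hshallow pp i w hw

include ht0 ht htq in
/-- **PER DATUM, BRANCH C's ANTECEDENT «∃ ρ qK, QPinned ∧ PilotKummerCompatHull» IS INHABITED at tame q-shallow genuine `K`-level data**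
(any columns `col`), under the same hypotheses — i.e. the per-datum form of the S_H hypothesis whose ∀-form `Conditional.not_hSH_v6K` refutes
is INHABITED at such data (realising ideles; via `exists_qPinned_and_hull_settingPrVolSharp_of_realises_minRam`).
[cite: Mochizuki2012, IUTchI Def. 3.1 (b),(c) pp. 61–62; Ex. 3.2 (iv) p. 71; IUTchIII Step (xi) (xi-f) p. 184] [cite: DupuyHilado2025, §3.3, §3.4, §4.9]
[claim: Mochizuki2012, status: disputed] -/
theorem exists_qPinned_and_hull_settingPrVolSharp_pilotDataOfK_of_shallow (m : Nat.Primes → ℕ) (hm1 : ∀ pp, 1 ≤ m pp)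
    (htame : ∀ (pp : Nat.Primes) (x : (thetaIndex (pilotDataOfK D K)).Fibre (.inr pp)),
      haveI : Fact (pp : ℕ).Prime := ⟨pp.2⟩
      (∃ w : (thetaIndex (pilotDataOfK D K)).Fibre (.inr pp), placeOf (pilotDataOfK D K) pp.1 w ∈ (pilotDataOfK D K).S) →
        2 < (pp : ℕ) ∧ m pp ≤ (placeOf (pilotDataOfK D K) pp.1 x).asIdeal.ramificationIdx ℤ ∧
          (placeOf (pilotDataOfK D K) pp.1 x).asIdeal.ramificationIdx ℤ ≤ (pp : ℕ) - 2)
    (hshallow : ∀ (pp : Nat.Primes) (w : (thetaIndex (pilotDataOfK D K)).Fibre (.inr pp)),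
      haveI : Fact (pp : ℕ).Prime := ⟨pp.2⟩
      placeOf (pilotDataOfK D K) pp.1 w ∈ (pilotDataOfK D K).S →
        m pp * ((pilotDataOfK D K).lstar ^ 2 - 1) * qParamOrd E (finBelow F K (placeOf (pilotDataOfK D K) pp.1 w)) ≤
          2 * l * (pilotDataOfK D K).lstar * ramIdx F (finBelow F K (placeOf (pilotDataOfK D K) pp.1 w)) * (m pp - 1)) :
    ∃ (ρ' : (∀ v : (thetaIndex (pilotDataOfK D K)).V, v ∈ (thetaIndex (pilotDataOfK D K)).Vbad →
            Set ((logShellsDH (pilotDataOfK D K) logv).StarPacket v)) →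
          ∀ (j : (thetaIndex (pilotDataOfK D K)).Label) (vQ : (thetaIndex (pilotDataOfK D K)).VQ),
            Set ((logShellsDH (pilotDataOfK D K) logv).Packet j vQ))
        (qK : ∀ v : (thetaIndex (pilotDataOfK D K)).V, v ∈ (thetaIndex (pilotDataOfK D K)).Vbad →
          Set ((logShellsDH (pilotDataOfK D K) logv).StarPacket v)),
        QPinned ({ toSituation := situationPrVol (pilotDataOfK D K) hlog M archPk archSub Ψ act Mmod region, col := col } :
            LatticeSituation (thetaIndex (pilotDataOfK D K)))
          (settingPrVolSharp (pilotDataOfK D K) hlog M archPk archSub Ψ act Mmod region n lat sig split qData tq t htq0 htq1) ρ' qK ∧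
        PilotKummerCompatHull ({ toSituation := situationPrVol (pilotDataOfK D K) hlog M archPk archSub Ψ act Mmod region, col := col } :
            LatticeSituation (thetaIndex (pilotDataOfK D K)))
          (settingPrVolSharp (pilotDataOfK D K) hlog M archPk archSub Ψ act Mmod region n lat sig split qData tq t htq0 htq1) ρ' qK := by
  refine exists_qPinned_and_hull_settingPrVolSharp_of_realises_minRam (pilotDataOfK D K) hlog M archPk archSub Ψ act Mmod region n lat sig
    split qData tq t htq0 htq1 col ht0 ht htq m hm1 htame (fun pp i w hw => ?_)
  haveI : Fact (pp : ℕ).Prime := ⟨pp.2⟩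
  exact level_pilotDataOfK_of_shallow D m hm1 hshallow pp i w hw

end Summit.ABC.IUTFork.Cor312Prov

end
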